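import Literature.NumberTheory.EllipticCurves.ZpExtensionGaloisTwistLevelDualGlobalProofs
import Literature.NumberTheory.GaloisCohomology.PoitouTateSelmerStructures
import HarnessLib

/-!
# The "tower" input of the eventual Poitou–Tate lifting from a UNIFORM EXPONENT of the dual Selmer groups
# (proofs; change of level on the dual side, `J' = J + e`)

Topic `NumberTheory/EllipticCurves`; namespace `WeierstrassCurve`. THEOREMS ONLY (no definition, no named fact, no
instance). Sequel of `ZpExtensionGaloisTwistLevelDualGlobalProofs` (`map_twistedTorsionInclDual_eq_zero_of_smul_eq_zero`:
`H¹(ι^D) y = 0` when `p^{J'−J} · y = 0` and `Hom(ker π, μ)` has no twisted invariants).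

Greenberg (LNM 1716, §4 p. 124) concludes the surjectivity of `γ : H¹(F_Σ/F, A_s) → 𝒫^Σ(A_s, F)` from «`S_{M*}(F)` finite
and `M*(F) = 0`». At finite level `M_J = E[p^J](χ_u)` the finiteness becomes a UNIFORM EXPONENT: `p^e` kills the dual Selmer
group `H¹_{𝓕_J^*}(K, M_J^D)` for every level `J` (and every family of local invariants) — and then, for `J' = J + e`, the
Poitou–Tate obstruction `H¹(ι^D) y` (`ι : M_J ↪ M_{J'}`) vanishes for every dual Selmer class `y` of level `J'`: the hypothesis
`htower` of `Summit…SignedEC.TwistedPT.exists_mem_selmerGroup_signedRelaxed_res_eq_map_incl_of_poitouTate`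
(`Summits/…/Theorems/ResidualThetaTransportAtTwoRlfTwistedEventualLiftOfPoitouTate.lean`), for ANY family of Selmer
structures `𝓕 = (𝓕_J)_J`.

* `tower_of_uniform_exponent` — `(∃ e, ∀ J inv (perfect, reciprocity, unramified duality), ∀ y ∈ H¹_{𝓕_J^*}, p^e · y = 0)` and
  «no twisted invariants in `Hom(ker π, μ)`» at all pairs of levels ⟹ `∀ J, ∃ J' ≥ J, ∀ inv …, ∀ y ∈ H¹_{𝓕_{J'}^*}, H¹(ι^D) y = 0`.

References: R. Greenberg, LNM 1716 (1999), §4 pp. 122–125 [GreenbergLNM1716]; B. Howard, Compositio Math. 140 (2004),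
Thm. 2.1.11 [Howard2004HeegnerKolyvagin].
-/

noncomputable section

open CategoryTheory Field NumberField IsDedekindDomain
open scoped ContRepresentation

universe u

namespace WeierstrassCurve

open Literature.NumberTheory.EllipticCurves Literature.NumberTheory.GaloisRepresentations
  Literature.NumberTheory.GaloisCohomology
open Literature.NumberTheory.GaloisRepresentations.DiscreteGaloisModule (TateDual tateDual SelmerStructure)

variable {K : Type u} [Field K] [NumberField K] (W : WeierstrassCurve K) [W.IsElliptic] (p : ℕ) [Fact p.Prime]
  (κ : ZpExtension K p) (u : ℤ) (hu : (p : ℤ) ∣ u - 1)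

/-- **The tower input from a uniform exponent.** Let `𝓕_J` be a Selmer structure on `E[p^J](χ_u)` for every `J`. If ONE
`p^e` kills the dual Selmer groups `H¹_{𝓕_J^*}(K, E[p^J](χ_u)^D)` at every level (for every perfect family of local
invariants with the reciprocity law and the unramified duality), and `Hom(ker π, μ)` has no twisted `Γ_K`-invariants for every
pair of levels `J ≤ J'` (`hinv`, e.g. from `E(K)[p] = 0` via the Weil pairing), then for every `J`, with `J' = J + e`,
`H¹(ι^D) y = 0` for every dual Selmer class `y` of level `J'`; granted the divisibility of `E(K̄)`.
[cite: GreenbergLNM1716, §4 pp. 122–125] -/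
theorem tower_of_uniform_exponent (hdiv : W.zsmul_geomPoints_surjective)
    [hfin : ∀ J : ℕ, Finite (W.geomTorsion ((p ^ J : ℕ) : ℤ))]
    (𝓕 : ∀ J : ℕ, SelmerStructure (W.twistedTorsionGaloisModule p κ J u hu))
    (hinv : ∀ (j J : ℕ) (hjJ : j ≤ J) (m : TateDual K (W.geomTorsion ((p ^ J : ℕ) : ℤ)) (p ^ J)),
      (∀ (g : absoluteGaloisGroup K) (R : W.geomTorsion ((p ^ J : ℕ) : ℤ)), W.twistedTorsionMulPow p κ hjJ u hu R = 0 →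
        ((W.twistedTorsionGaloisModule p κ J u hu).tateDual (p ^ J) g m - m) R = 0) →
      ∀ R : W.geomTorsion ((p ^ J : ℕ) : ℤ), W.twistedTorsionMulPow p κ hjJ u hu R = 0 → m R = 0)
    (hexp : ∃ e : ℕ, ∀ (J : ℕ) (inv : LocalInvariants K (p ^ J)), inv.IsPerfect → inv.SumLocalTermEqZero →
      inv.UnramifiedOrthogonal →
      ∀ y ∈ (inv.dualSelmerStructure (W.twistedTorsionGaloisModule p κ J u hu) (𝓕 J)).selmerGroup, p ^ e • y = 0) :
    ∀ J : ℕ, ∃ (J' : ℕ) (hJ : J ≤ J'), ∀ inv : LocalInvariants K (p ^ J'), inv.IsPerfect → inv.SumLocalTermEqZero →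
      inv.UnramifiedOrthogonal →
      ∀ y ∈ (inv.dualSelmerStructure (W.twistedTorsionGaloisModule p κ J' u hu) (𝓕 J')).selmerGroup,
        galoisCohomology.map (W.twistedTorsionInclDual p κ hJ u hu) 1 y = 0 := by
  obtain ⟨e, he⟩ := hexp
  intro J
  refine ⟨J + e, Nat.le_add_right J e, fun inv hperf hvan hur y hy ↦ ?_⟩
  refine W.map_twistedTorsionInclDual_eq_zero_of_smul_eq_zero p κ (Nat.le_add_right J e) u hu hdiv
    (hinv J (J + e) (Nat.le_add_right J e)) y ?_
  rw [Nat.add_sub_cancel_left]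
  exact he (J + e) inv hperf hvan hur y hy

end WeierstrassCurve

end
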